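import Summits.FinalStateConjecture.FinalStateConjecture.Theses.DerivativeThrift
import Summits.FinalStateConjecture.FinalStateConjecture.Theses.PhaseMixingCapture
import Summits.FinalStateConjecture.FinalStateConjecture.Theses.TangentConeAtIPlus
import Literature.Geometry.Lorentzian.TameGenericityDiagonal

/-!
# `ThriftyHandoff` (stmt-FinalStateConjecture-17612, route DerivativeThrift, rank 4):
# the by-name reductions of line `registered` (birth skeleton)

Helper file of the line lead (crux `DerivativeThrift.ThriftyHandoff`; skeleton
`Cruxes/ThriftyHandoff/Lines/birth.lean`). The crux is ONE tame-Christodoulou-generic property of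
admissible data: an MGHD exists and every MGHD (i) has complete `𝓘⁺`, (ii) captures rays for every
honest typed decomposition `(O, d)` (`RaysStayInClosure`), (iii) admits a thrifty hand-over
(`N` sub-extremal labels, orthochronous boosts with pairwise distinct velocities, arbitrarily late
`ε`-thrifty separating `N`-hole layers in the `k = 2` layer norm `𝔑_(2,1/2,1/2)`).
Everything here is sorry-free, definition-free pure logic over the tame-genericity kernel
`InitialDataSet.isTameChristodoulouGeneric_of_relative` / `IsTameChristodoulouGeneric.mono`; the
hypotheses are existing route items BY NAME or the line's two registered stub bodies verbatim:

* `weakCosmicCensorshipTame_of_thriftyHandoff` — NECESSITY of the censorship leg: the crux implies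
  item stmt-FinalStateConjecture-17269 (`PhaseMixingCapture.WeakCosmicCensorshipTame`, tame weak
  cosmic censorship in MGHD form) by monotonicity (cross-route record: DerivativeThrift rank 4 ⇒
  PhaseMixingCapture rank 5; the crux cannot close before 17269 does).
* `thriftyHandoff_of_legs` — SUFFICIENCY, the line composition in hypothetical form: the crux from
  item 17269 BY NAME, item 17673 (`TangentConeAtIPlus.SettledExteriorHoldsRays` =
  `RaychaudhuriBlowdown.SettledExteriorHoldsRays`, shared) BY NAME, and the two line-specific legs
  written out verbatim — the registered stubs `stub_recessionAlongCensoredCurves` (the generic third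
  law + generic hyperbolic recession as ONE transversality statement along censored tame curves) and
  `stub_censoredCapture` (pointwise WEAK thrifty hand-over of every censored MGHD: closed labels
  `|aᵢ| ≤ Mᵢ`, no velocity condition).

Nothing here is analysis; the physics of the crux sits entirely in the four hypotheses, each an
open problem in print (Lines/birth.md). Slack audit recorded with the item (PICKED.md): in clause
(iii) the lab time `τ` is absorbed by the chart `Φ` (time translation covariance of
`RecedingKerr.layer`/`background`/`𝔑`), so "arbitrarily late" carries no intrinsic content; this
does not make any leg provable.
-/

-- the doubled `FinalStateConjecture.FinalStateConjecture` path component trips dupNamespace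
set_option linter.dupNamespace false

noncomputable section

open scoped Manifold ContDiff Topology
open Set Function

namespace Summit.FinalStateConjecture.FinalStateConjecture.Theorems.DerivativeThriftThriftyHandoff

open Literature.Geometry.Lorentzian
open Summit.FinalStateConjecture.FinalStateConjecture.Theses
open Summit.FinalStateConjecture.FinalStateConjecture.Theses.DerivativeThrift (ThriftyHandoff)
open Summit.FinalStateConjecture.FinalStateConjecture.Theses.PhaseMixingCapture (WeakCosmicCensorshipTame)
open Summit.FinalStateConjecture.FinalStateConjecture.Theses.TangentConeAtIPlus (SettledExteriorHoldsRays)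

/-- **The crux implies tame weak cosmic censorship** (item stmt-FinalStateConjecture-17269,
`PhaseMixingCapture.WeakCosmicCensorshipTame`): delete conjuncts (ii), (iii) of the generic property
and transport tame genericity along the pointwise implication (`IsTameChristodoulouGeneric.mono`).
Christodoulou, CQG 16 (1999) A23, p. A24 (genericity = exceptional set of positive codimension is
antitone in the property). [cite: Christodoulou1999, p. A24] -/
theorem weakCosmicCensorshipTame_of_thriftyHandoff (h : ThriftyHandoff) :
    WeakCosmicCensorshipTame := by
  intro X _ _ _ _ _ _
  refine (h X).mono ?_
  intro D _ hQ
  exact ⟨hQ.1, fun 𝒟 h𝒟 ↦ (hQ.2 𝒟 h𝒟).1⟩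

/-- **The crux from its four legs (line composition, hypothetical form, items by name).**
`ThriftyHandoff` follows from: (1) tame weak cosmic censorship `WeakCosmicCensorshipTame`
(stmt-FinalStateConjecture-17269); (2) the generic legs along censored tame curves (registered stub
`stub_recessionAlongCensoredCurves`, verbatim): every tame curve of admissible data on an end `e`
whose members off `0` are censored — immersed-at-`0` and injective, or constant — is answered by a
tame injective immersed admissible curve on the same end through the same base datum whose members
off `0` are censored and UPGRADABLE (weak hand-over ⇒ hand-over with sub-extremal labels and pairwise
distinct terminal velocities); (3) censored thrift capture, pointwise (registered stub
`stub_censoredCapture`, verbatim): every censored MGHD of admissible data admits a weak thrifty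
hand-over; (4) `SettledExteriorHoldsRays` (stmt-FinalStateConjecture-17673): rays are captured by
every honest decomposition of every censored MGHD. Proof: the kernel
`isTameChristodoulouGeneric_of_relative` with `Q :=` censorship (1), curves handed back by (2),
sole strongly flat ends from `exists_isSoleEnd_of_mem_admissibleVacuumData`; then `.mono` with (3)
and (4) pointwise. Genericity is produced along censorship curves, never by conjunction (tame
genericity is not closed under `∧`). Christodoulou, CQG 16 (1999) A23, p. A24. [cite: Christodoulou1999, p. A24] -/
theorem thriftyHandoff_of_legs (h₁ : WeakCosmicCensorshipTame)
    (h₂ : open Literature.Geometry.Lorentzian in open scoped Manifold in ∀ (X : Type) [TopologicalSpace X] [ChartedSpace E3 X] [IsManifold (𝓡 3) ((⊤ : ℕ∞) : WithTop ℕ∞) X] [T2Space X] [SecondCountableTopology X] [ConnectedSpace X], ∀ (e : AFEnd X) (F : EuclideanSpace ℝ (Fin 1) → InitialDataSet (𝓡 3) X), InitialDataSet.IsTameDataFamily e 1 F → ((InitialDataSet.IsImmersedAtZero 1 F ∧ Function.Injective F) ∨ ∀ c, F c = F 0) → (∀ c, F c ∈ admissibleVacuumData X) → (∀ c ≠ 0,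 (∃ 𝒟 : VacuumCauchyDevelopment (F c), 𝒟.IsMaximal) ∧ ∀ 𝒟 : VacuumCauchyDevelopment (F c), 𝒟.IsMaximal → Summit.FinalStateConjecture.HasCompleteNullInfinity 𝒟.toCauchyDevelopment) → ∃ F' : EuclideanSpace ℝ (Fin 1) → InitialDataSet (𝓡 3) X, InitialDataSet.IsTameDataFamily e 1 F' ∧ F' 0 = F 0 ∧ Function.Injective F' ∧ InitialDataSet.IsImmersedAtZero 1 F' ∧ (∀ c, F' c ∈ admissibleVacuumData X) ∧ ∀ c ≠ 0, (∃ 𝒟 : VacuumCauchyDevelopment (F' c), 𝒟.IsMaximal) ∧ ∀ 𝒟 : VacuumCauchyDevelopment (F' c), 𝒟.IsMaximal → Summit.FinalStateConjecture.HasCompleteNullInfinity 𝒟.toCauchyDevelopment ∧ ((∃ (N : ℕ) (M a : Fin N → ℝ) (Λ : Fin N → ↥lorentzGroup), (∀ i, Kerr.IsSubextremal (M i) (a i) ∨ Kerr.IsExtremal (M i) (a i)) ∧ (∀ i, Summit.FinalStateConjecture.IsOrthochronous (Λ i)) ∧ ∀ ℓ : ℝ, 0 < ℓ → ∀ ε :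 ℝ, 0 < ε → ∀ τ₁ : ℝ, ∃ τ : ℝ, τ₁ ≤ τ ∧ ∃ (ξ : Fin N → E3) (Φ : RecedingKerr.layer M a Λ ξ τ ℓ → 𝒟.carrier), (∀ i j, i ≠ j → ε⁻¹ ≤ ‖ξ i - ξ j‖ ∧ 0 ≤ @inner ℝ E3 _ (ξ i - ξ j) ( (((Λ i : E4 ≃L[ℝ] E4) (E4.basisVector 0)) 0)⁻¹ • E4.spatial ((Λ i : E4 ≃L[ℝ] E4) (E4.basisVector 0)) - (((Λ j : E4 ≃L[ℝ] E4) (E4.basisVector 0)) 0)⁻¹ • E4.spatial ((Λ j : E4 ≃L[ℝ] E4) (E4.basisVector 0)))) ∧ ContMDiff 𝓘(ℝ, E4) (𝓡 4) ((⊤ : ℕ∞) : WithTop ℕ∞) Φ ∧ Topology.IsOpenEmbedding Φ ∧ Set.range Φ ⊆ 𝒟.metric.causalFuture 𝒟.timeOrientation (Set.range 𝒟.embed) ∧ (∀ s₀ ∈ Set.Ioo 0 ℓ, 𝒟.metric.IsAchronal 𝒟.timeOrientation (Φ '' {x | RecedingKerr.layerTime τ ℓ x.1 = s₀})) ∧ 𝒟.toSpacetime.recedingKerrInitialLayerNorm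 M a Λ ξ τ ℓ 2 (1 / 2) (1 / 2) Φ ≤ ENNReal.ofReal ε) → (∃ (N : ℕ) (M a : Fin N → ℝ) (Λ : Fin N → ↥lorentzGroup), (∀ i, Kerr.IsSubextremal (M i) (a i)) ∧ (∀ i, Summit.FinalStateConjecture.IsOrthochronous (Λ i)) ∧ (∀ i j, i ≠ j → (((Λ i : E4 ≃L[ℝ] E4) (E4.basisVector 0)) 0)⁻¹ • E4.spatial ((Λ i : E4 ≃L[ℝ] E4) (E4.basisVector 0)) ≠ (((Λ j : E4 ≃L[ℝ] E4) (E4.basisVector 0)) 0)⁻¹ • E4.spatial ((Λ j : E4 ≃L[ℝ] E4) (E4.basisVector 0))) ∧ ∀ ℓ : ℝ, 0 < ℓ → ∀ ε : ℝ, 0 < ε → ∀ τ₁ : ℝ, ∃ τ : ℝ, τ₁ ≤ τ ∧ ∃ (ξ : Fin N → E3) (Φ : RecedingKerr.layer M a Λ ξ τ ℓ → 𝒟.carrier), (∀ i j, i ≠ j → ε⁻¹ ≤ ‖ξ i - ξ j‖ ∧ 0 ≤ @inner ℝ E3 _ (ξ i - ξ j) ( (((Λ i : E4 ≃L[ℝ]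 E4) (E4.basisVector 0)) 0)⁻¹ • E4.spatial ((Λ i : E4 ≃L[ℝ] E4) (E4.basisVector 0)) - (((Λ j : E4 ≃L[ℝ] E4) (E4.basisVector 0)) 0)⁻¹ • E4.spatial ((Λ j : E4 ≃L[ℝ] E4) (E4.basisVector 0)))) ∧ ContMDiff 𝓘(ℝ, E4) (𝓡 4) ((⊤ : ℕ∞) : WithTop ℕ∞) Φ ∧ Topology.IsOpenEmbedding Φ ∧ Set.range Φ ⊆ 𝒟.metric.causalFuture 𝒟.timeOrientation (Set.range 𝒟.embed) ∧ (∀ s₀ ∈ Set.Ioo 0 ℓ, 𝒟.metric.IsAchronal 𝒟.timeOrientation (Φ '' {x | RecedingKerr.layerTime τ ℓ x.1 = s₀})) ∧ 𝒟.toSpacetime.recedingKerrInitialLayerNorm M a Λ ξ τ ℓ 2 (1 / 2) (1 / 2) Φ ≤ ENNReal.ofReal ε)))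
    (h₃ : open Literature.Geometry.Lorentzian in open scoped Manifold in ∀ (X : Type) [TopologicalSpace X] [ChartedSpace E3 X] [IsManifold (𝓡 3) ((⊤ : ℕ∞) : WithTop ℕ∞) X] [T2Space X] [SecondCountableTopology X] [ConnectedSpace X], ∀ D ∈ admissibleVacuumData X, ∀ 𝒟 : VacuumCauchyDevelopment D, 𝒟.IsMaximal → Summit.FinalStateConjecture.HasCompleteNullInfinity 𝒟.toCauchyDevelopment → ∃ (N : ℕ) (M a : Fin N → ℝ) (Λ : Fin N → ↥lorentzGroup), (∀ i, Kerr.IsSubextremal (M i) (a i) ∨ Kerr.IsExtremal (M i) (a i)) ∧ (∀ i, Summit.FinalStateConjecture.IsOrthochronous (Λ i)) ∧ ∀ ℓ : ℝ, 0 < ℓ → ∀ ε : ℝ, 0 < ε → ∀ τ₁ : ℝ, ∃ τ : ℝ, τ₁ ≤ τ ∧ ∃ (ξ : Fin N → E3) (Φ : RecedingKerr.layer M a Λ ξ τ ℓ → 𝒟.carrier), (∀ i j, i ≠ j → ε⁻¹ ≤ ‖ξ i - ξ j‖ ∧ 0 ≤ @inner ℝ E3 _ (ξ i - ξ j) ( (((Λ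 i : E4 ≃L[ℝ] E4) (E4.basisVector 0)) 0)⁻¹ • E4.spatial ((Λ i : E4 ≃L[ℝ] E4) (E4.basisVector 0)) - (((Λ j : E4 ≃L[ℝ] E4) (E4.basisVector 0)) 0)⁻¹ • E4.spatial ((Λ j : E4 ≃L[ℝ] E4) (E4.basisVector 0)))) ∧ ContMDiff 𝓘(ℝ, E4) (𝓡 4) ((⊤ : ℕ∞) : WithTop ℕ∞) Φ ∧ Topology.IsOpenEmbedding Φ ∧ Set.range Φ ⊆ 𝒟.metric.causalFuture 𝒟.timeOrientation (Set.range 𝒟.embed) ∧ (∀ s₀ ∈ Set.Ioo 0 ℓ, 𝒟.metric.IsAchronal 𝒟.timeOrientation (Φ '' {x | RecedingKerr.layerTime τ ℓ x.1 = s₀})) ∧ 𝒟.toSpacetime.recedingKerrInitialLayerNorm M a Λ ξ τ ℓ 2 (1 / 2) (1 / 2) Φ ≤ ENNReal.ofReal ε)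
    (h₄ : SettledExteriorHoldsRays) : ThriftyHandoff := by
  intro X _ _ _ _ _ _
  -- tame genericity of the UPGRADABLE censored property, produced along censorship curves
  have key : InitialDataSet.IsTameChristodoulouGeneric (admissibleVacuumData X) (fun D ↦ (∃ 𝒟 : VacuumCauchyDevelopment D, 𝒟.IsMaximal) ∧ ∀ 𝒟 : VacuumCauchyDevelopment D, 𝒟.IsMaximal → Summit.FinalStateConjecture.HasCompleteNullInfinity 𝒟.toCauchyDevelopment ∧ ((∃ (N : ℕ) (M a : Fin N → ℝ) (Λ : Fin N → ↥lorentzGroup), (∀ i, Kerr.IsSubextremal (M i) (a i) ∨ Kerr.IsExtremal (M i) (a i)) ∧ (∀ i, Summit.FinalStateConjecture.IsOrthochronous (Λ i)) ∧ ∀ ℓ : ℝ, 0 < ℓ → ∀ ε : ℝ, 0 < ε → ∀ τ₁ : ℝ, ∃ τ : ℝ, τ₁ ≤ τ ∧ ∃ (ξ : Fin N → E3) (Φ : RecedingKerr.layer M a Λ ξ τ ℓ → 𝒟.carrier), (∀ i j, i ≠ j → ε⁻¹ ≤ ‖ξ i - ξ j‖ ∧ 0 ≤ @inner ℝ E3 _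 (ξ i - ξ j) ( (((Λ i : E4 ≃L[ℝ] E4) (E4.basisVector 0)) 0)⁻¹ • E4.spatial ((Λ i : E4 ≃L[ℝ] E4) (E4.basisVector 0)) - (((Λ j : E4 ≃L[ℝ] E4) (E4.basisVector 0)) 0)⁻¹ • E4.spatial ((Λ j : E4 ≃L[ℝ] E4) (E4.basisVector 0)))) ∧ ContMDiff 𝓘(ℝ, E4) (𝓡 4) ((⊤ : ℕ∞) : WithTop ℕ∞) Φ ∧ Topology.IsOpenEmbedding Φ ∧ Set.range Φ ⊆ 𝒟.metric.causalFuture 𝒟.timeOrientation (Set.range 𝒟.embed) ∧ (∀ s₀ ∈ Set.Ioo 0 ℓ, 𝒟.metric.IsAchronal 𝒟.timeOrientation (Φ '' {x | RecedingKerr.layerTime τ ℓ x.1 = s₀})) ∧ 𝒟.toSpacetime.recedingKerrInitialLayerNorm M a Λ ξ τ ℓ 2 (1 / 2) (1 / 2) Φ ≤ ENNReal.ofReal ε) → (∃ (N : ℕ) (M a : Fin N → ℝ) (Λ : Fin N → ↥lorentzGroup), (∀ i, Kerr.IsSubextremal (M i) (a i)) ∧ (∀ i, Summit.FinalStateConjecture.IsOrthochronous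 (Λ i)) ∧ (∀ i j, i ≠ j → (((Λ i : E4 ≃L[ℝ] E4) (E4.basisVector 0)) 0)⁻¹ • E4.spatial ((Λ i : E4 ≃L[ℝ] E4) (E4.basisVector 0)) ≠ (((Λ j : E4 ≃L[ℝ] E4) (E4.basisVector 0)) 0)⁻¹ • E4.spatial ((Λ j : E4 ≃L[ℝ] E4) (E4.basisVector 0))) ∧ ∀ ℓ : ℝ, 0 < ℓ → ∀ ε : ℝ, 0 < ε → ∀ τ₁ : ℝ, ∃ τ : ℝ, τ₁ ≤ τ ∧ ∃ (ξ : Fin N → E3) (Φ : RecedingKerr.layer M a Λ ξ τ ℓ → 𝒟.carrier), (∀ i j, i ≠ j → ε⁻¹ ≤ ‖ξ i - ξ j‖ ∧ 0 ≤ @inner ℝ E3 _ (ξ i - ξ j) ( (((Λ i : E4 ≃L[ℝ] E4) (E4.basisVector 0)) 0)⁻¹ • E4.spatial ((Λ i : E4 ≃L[ℝ] E4) (E4.basisVector 0)) - (((Λ j : E4 ≃L[ℝ] E4) (E4.basisVector 0)) 0)⁻¹ • E4.spatial ((Λ j : E4 ≃L[ℝ] E4) (E4.basisVector 0)))) ∧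 ContMDiff 𝓘(ℝ, E4) (𝓡 4) ((⊤ : ℕ∞) : WithTop ℕ∞) Φ ∧ Topology.IsOpenEmbedding Φ ∧ Set.range Φ ⊆ 𝒟.metric.causalFuture 𝒟.timeOrientation (Set.range 𝒟.embed) ∧ (∀ s₀ ∈ Set.Ioo 0 ℓ, 𝒟.metric.IsAchronal 𝒟.timeOrientation (Φ '' {x | RecedingKerr.layerTime τ ℓ x.1 = s₀})) ∧ 𝒟.toSpacetime.recedingKerrInitialLayerNorm M a Λ ξ τ ℓ 2 (1 / 2) (1 / 2) Φ ≤ ENNReal.ofReal ε))) 1 :=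
    InitialDataSet.isTameChristodoulouGeneric_of_relative
      (fun d hd ↦ exists_isSoleEnd_of_mem_admissibleVacuumData hd) (h₁ X) (h₂ X)
  -- pointwise upgrade on admissible data: completeness is copied, the weak hand-over of (3) is
  -- upgraded along the curve property, the ray clause is (4) at the honest decomposition
  refine key.mono ?_
  intro D hD hP
  refine ⟨hP.1, fun 𝒟 h𝒟 ↦ ?_⟩
  obtain ⟨hc, hup⟩ := hP.2 𝒟 h𝒟
  exact ⟨hc, h₄ X D hD 𝒟 h𝒟 hc, hup (h₃ X D hD 𝒟 h𝒟 hc)⟩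

end Summit.FinalStateConjecture.FinalStateConjecture.Theorems.DerivativeThriftThriftyHandoff

end
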